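import Literature.Probability.RandomPlanarGeometry.SAWTriangularPolygonUnrooting
import Literature.Probability.RandomPlanarGeometry.SAWTriangularPolygonJoinDecode
import HarnessLib

/-!
# Madras' join on `𝕋`: two rooted readings of one polygon with row-separated cuts at `0` and the same orientation coincide

Topic `Literature/Probability/RandomPlanarGeometry` (lane «pcv-sawmu», LINE «TRI-MADRAS», step S4𝕋 (c) — the injectivity core;
continues `SAWTriangularPolygonUnrooting.lean` (`loops n`, `rotF`, `rotB`, `unroot`, `addc`, `subc`: every closing walk is a
re-rooting `unroot n (ω, r, b)` of a canonical traversal `ω`) and `SAWTriangularPolygonJoinDecode.lean` (`IsRowSepCut`,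
`isRowSepCut_shift`, `isRowSepCut_unique`)).

Source.  A. Hammond, arXiv:1504.05286 [Hammond2015SAPJoining], §3.2 p. 10 and §4.4 p. 27, (4.9) (arXiv v5): the junction plaquette of a
Madras join polygon is recovered from the polygon, which makes the join injective (§4.1 pp. 17–20 for the construction); N. Madras, J. Stat. Phys. 78 (1995)
[Madras1995LatticeAnimalsExponent], §2.  Here, on `𝕋` (brick frame): if two closing walks `ρ₁, ρ₂ ∈ loops (2M−1)` are re-rootings
of the same walk `ω` (i.e. traverse the same polygon up to translation), both have the row-separated equal-split cut at `0`
(`IsRowSepCut M (ρᵢ ∘ (· % 2M)) 0`) and both have first coordinate `+1` at time `M − 1` (`ρᵢ (M−1) = (1,±1)`: the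
orientation of the lane's join and of its `Y`-mirror, see `SAWTriangularPolygonJoinMerge.lean`), then `ρ₁ = ρ₂` — so the canonical traversal of a joined polygon determines the joined walk.

## What is proved (namespace `…SAW.TriPolygon`)
* `isRowSepCut_translate`, `isRowSepCut_unshift`, `isRowSepCut_reverse` (a cut of the reversed reading is a cut of the reading);
* `rotF_mod`, `rotB_mod` (cyclic readings of the re-rooted walks);
* **`eq_of_unroot_of_cuts`** — the statement above.
-/

noncomputable section

open Finset Literature.Probability.LatticeModels Literature.Probability.Percolation SimpleGraph

namespace Literature.Probability.RandomPlanarGeometry.SAW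

namespace TriPolygon

variable {N : ℕ} {v : ℕ → Site 2}

/-! ### Three more symmetries of `IsRowSepCut` -/

/-- A cut is invariant under translating all sites by a constant vector. [cite: Hammond2015SAPJoining, Definition 4.3 (arXiv v5 p. 20)] -/
theorem isRowSepCut_translate {j : ℕ} (c : Site 2) (h : IsRowSepCut N v j) :
    IsRowSepCut N (fun i => v i + c) j := by
  obtain ⟨⟨hq1, hq0⟩, ⟨hw1, hw0⟩, ⟨hu1, hu0⟩, sep⟩ := h
  refine ⟨⟨?_, ?_⟩, ⟨?_, ?_⟩, ⟨?_, ?_⟩, ?_⟩ <;> simp only [Pi.add_apply]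
  · rw [hq1]
  · rw [hq0]; ring
  · rw [hw1]
  · rw [hw0]; ring
  · rcases hu1 with h | h
    · left; rw [h]; ring
    · right; rw [← h]; ring
  · rcases hu0 with h | h
    · left; rw [h]; ring
    · right; rw [← h]; ring
  · intro a b ha1 ha2 hb1 hb2 hrow
    have := sep a b ha1 ha2 hb1 hb2 (by simpa using hrow)
    omega

/-- Converse re-indexing: a cut of `v (· + r)` at `0` is a cut of `v` at `r`. [cite: Hammond2015SAPJoining, Definition 4.3 (arXiv v5 p. 20)] -/
theorem isRowSepCut_unshift (hN : 1 ≤ N) {r : ℕ} (h : IsRowSepCut N (fun i => v (i + r)) 0) : IsRowSepCut N v r := by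
  obtain ⟨⟨hq1, hq0⟩, ⟨hw1, hw0⟩, ⟨hu1, hu0⟩, sep⟩ := h
  simp only [Nat.zero_add] at hq1 hq0 hw1 hw0 hu1 hu0
  rw [show 2 * N - 1 + r = r + 2 * N - 1 by omega] at hq1 hq0
  rw [show N + r = r + N by omega, show N - 1 + r = r + N - 1 by omega] at hw1 hw0
  rw [show N - 1 + r = r + N - 1 by omega] at hu1 hu0
  refine ⟨⟨hq1, hq0⟩, ⟨hw1, hw0⟩, ⟨hu1, hu0⟩, ?_⟩
  intro a b ha1 ha2 hb1 hb2 hrow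
  have key := sep (a - r) (b - r) (by omega) (by omega) (by omega) (by omega)
  simp only [] at key
  rw [Nat.sub_add_cancel ha1, Nat.sub_add_cancel (show r ≤ b by omega)] at key
  exact key hrow

/-- periodic extension: `v (i + 2N·q) = v i`. [folklore] -/
private theorem per_mul (hper : ∀ i, v (i + 2 * N) = v i) (i q : ℕ) : v (i + 2 * N * q) = v i := by
  induction q with
  | zero => simp
  | succ q ih => rw [Nat.mul_succ, ← Nat.add_assoc, hper, ih]

/-- **The reversed reading.** If the `2N`-periodic sequence read BACKWARDS from `r`, `i ↦ v (r + 2N − (i mod 2N))`, has a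
row-separated cut at `0`, then `v` itself has one at `r + N + 1` (left arc `v[r+N+1, r+2N]` = the old left arc reversed,
junction sides swapped). [cite: Hammond2015SAPJoining, Definition 4.3 (arXiv v5 p. 20: the junction plaquette does not depend on the
orientation)] -/
theorem isRowSepCut_reverse (hN : 1 ≤ N) (hper : ∀ i, v (i + 2 * N) = v i) (r : ℕ)
    (h : IsRowSepCut N (fun i => v (r + 2 * N - i % (2 * N))) 0) : IsRowSepCut N v (r + N + 1) := by
  obtain ⟨⟨hq1, hq0⟩, ⟨hw1, hw0⟩, ⟨hu1, hu0⟩, sep⟩ := h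
  -- evaluate the reversed reading at the four junction indices
  have m0 : (0 : ℕ) % (2 * N) = 0 := Nat.zero_mod _
  have m1 : (0 + 2 * N - 1) % (2 * N) = 2 * N - 1 := by rw [Nat.zero_add]; exact Nat.mod_eq_of_lt (by omega)
  have m2 : (0 + N) % (2 * N) = N := by rw [Nat.zero_add]; exact Nat.mod_eq_of_lt (by omega)
  have m3 : (0 + N - 1) % (2 * N) = N - 1 := by rw [Nat.zero_add]; exact Nat.mod_eq_of_lt (by omega)
  simp only [m0, m1, m2, m3] at hq1 hq0 hw1 hw0 hu1 hu0
  rw [show r + 2 * N - (2 * N - 1) = r + 1 by omega, show r + 2 * N - 0 = r + 2 * N by omega, hper] at hq1 hq0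
  rw [show r + 2 * N - (N - 1) = r + N + 1 by omega] at hw1 hw0 hu1 hu0
  rw [show r + 2 * N - 0 = r + 2 * N by omega, hper] at hu1 hu0
  -- the junction indices of `v` at `j = r + N + 1`
  have i1 : v (r + N + 1 + 2 * N - 1) = v (r + 2 * N - N) := by
    rw [show r + N + 1 + 2 * N - 1 = (r + 2 * N - N) + 2 * N by omega, hper]
  have i2 : v (r + N + 1 + N) = v (r + 1) := by rw [show r + N + 1 + N = (r + 1) + 2 * N by omega, hper]
  have i3 : v (r + N + 1 + N - 1) = v r := by rw [show r + N + 1 + N - 1 = r + 2 * N by omega, hper]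
  rw [show r + 2 * N - N = r + N by omega] at hw1 hw0
  have i1' : v (r + N + 1 + 2 * N - 1) = v (r + N) := by rw [i1, show r + 2 * N - N = r + N by omega]
  refine ⟨⟨?_, ?_⟩, ⟨?_, ?_⟩, ⟨?_, ?_⟩, ?_⟩
  · rw [i1']; exact hw1
  · rw [i1']; omega
  · rw [i2, i3]; exact hq1
  · rw [i2, i3]; omega
  · rw [i3]; rcases hu1 with h | h
    · right; omega
    · left; omega
  · rw [i3]; rcases hu0 with h | h
    · right; omega
    · left; omega
  · intro a b ha1 ha2 hb1 hb2 hrow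
    -- `v a = w (r + 2N - a')` etc.: write `a = r + N + 1 + s`, `b = r + 2N + 1 + s'`
    obtain ⟨s, rfl⟩ : ∃ s, a = r + N + 1 + s := ⟨a - (r + N + 1), by omega⟩
    obtain ⟨s', rfl⟩ : ∃ s', b = r + 2 * N + 1 + s' := ⟨b - (r + 2 * N + 1), by omega⟩
    have hs : s < N := by omega
    have hs' : s' < N := by omega
    have ea : v (r + N + 1 + s) = v (r + 2 * N - (N - 1 - s) % (2 * N)) := by
      rw [Nat.mod_eq_of_lt (by omega)]; congr 1; omega
    have eb : v (r + 2 * N + 1 + s') = v (r + 2 * N - (2 * N - 1 - s') % (2 * N)) := by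
      rw [Nat.mod_eq_of_lt (by omega), show r + 2 * N + 1 + s' = (r + 1 + s') + 2 * N by omega, hper]; congr 1; omega
    rw [ea, eb] at hrow ⊢
    exact sep (N - 1 - s) (2 * N - 1 - s') (Nat.zero_le _) (by omega) (by omega) (by omega) hrow

/-! ### Cyclic readings of re-rooted walks -/

variable {n : ℕ} {ω : ℕ → Site 2}

/-- `addc` is addition mod `n+1`. [folklore] -/
private theorem addc_eq_mod {r j : ℕ} (hr : r ≤ n) (hj : j ≤ n) : addc n r j = (r + j) % (n + 1) := by
  unfold addc; split_ifs with h
  · exact (Nat.mod_eq_of_lt (by omega)).symm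
  · rw [Nat.mod_eq_sub_mod (by omega), Nat.mod_eq_of_lt (by omega)]

/-- `subc` is subtraction mod `n+1`. [folklore] -/
private theorem subc_eq_mod {r j : ℕ} (hr : r ≤ n) (hj : j ≤ n) : subc n r j = (r + (n + 1) - j) % (n + 1) := by
  unfold subc; split_ifs with h
  · rw [show r + (n + 1) - j = (r - j) + (n + 1) by omega, Nat.add_mod_right, Nat.mod_eq_of_lt (by omega)]
  · exact (Nat.mod_eq_of_lt (by omega)).symm

/-- The cyclic reading of the forward re-rooting: `(rotF n ω r) (i mod L) = ω ((i + r) mod L) − ω r`, `L = n + 1`.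
[cite: MadrasSlade1993, §3.2, eq. (3.2.1)] -/
theorem rotF_mod {r : ℕ} (hr : r ≤ n) (i : ℕ) :
    rotF n ω r (i % (n + 1)) = ω ((i + r) % (n + 1)) - ω r := by
  have hj : i % (n + 1) ≤ n := Nat.le_of_lt_succ (Nat.mod_lt _ (Nat.succ_pos n))
  unfold rotF
  rw [min_eq_left hj, addc_eq_mod hr hj]
  congr 2
  rw [Nat.add_comm i r, Nat.add_mod r i, Nat.mod_eq_of_lt (show r < n + 1 by omega)]

/-- The cyclic reading of the backward re-rooting: `(rotB n ω r) (i mod L) = ω ((r + L − i mod L) mod L) − ω r`.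
[cite: MadrasSlade1993, §3.2, eq. (3.2.1)] -/
theorem rotB_mod {r : ℕ} (hr : r ≤ n) (i : ℕ) :
    rotB n ω r (i % (n + 1)) = ω ((r + (n + 1) - i % (n + 1)) % (n + 1)) - ω r := by
  have hj : i % (n + 1) ≤ n := Nat.le_of_lt_succ (Nat.mod_lt _ (Nat.succ_pos n))
  unfold rotB
  rw [min_eq_left hj, subc_eq_mod hr hj]

/-! ### The injectivity core -/

/-- consecutive sites of the cyclic reading of a closing walk are adjacent (as in `SAWTriangularPolygonJoinDecodeLoops.lean`).
[cite: MadrasSlade1993, §3.2, eq. (3.2.1), p. 63 (closing walks)] -/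
private theorem mod_adj (hρ : ω ∈ loops n) (i : ℕ) :
    brickGraph.Adj (ω (i % (n + 1))) (ω ((i + 1) % (n + 1))) := by
  obtain ⟨hs, hclose⟩ := mem_loops.1 hρ
  obtain ⟨h0, -, hadj, -⟩ := mem_brickSaws.1 hs
  have hlt : i % (n + 1) < n + 1 := Nat.mod_lt _ (Nat.succ_pos n)
  by_cases hr : i % (n + 1) = n
  · have h1 : (i + 1) % (n + 1) = 0 := by
      have h := Nat.add_mod i 1 (n + 1)
      rw [hr] at h
      rcases Nat.eq_zero_or_pos n with hn | hn
      · subst hn; simp [Nat.mod_one]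
      · rw [Nat.one_mod_eq_one.mpr (by omega), Nat.mod_self] at h
        exact h
    rw [hr, h1, h0]
    exact hclose
  · have hn : 0 < n := by
      rcases Nat.eq_zero_or_pos n with hn | hn
      · subst hn; simp [Nat.mod_one] at hr
      · exact hn
    have h1 : (i + 1) % (n + 1) = i % (n + 1) + 1 := by
      have h := Nat.add_mod i 1 (n + 1)
      rw [Nat.one_mod_eq_one.mpr (by omega), Nat.mod_eq_of_lt (show i % (n + 1) + 1 < n + 1 by omega)] at h
      exact h
    rw [h1]
    exact hadj _ (by omega)

/-- **Two re-rootings of one closing walk with row-separated cuts at `0` and the same orientation coincide.**  See the module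
docstring. [cite: Hammond2015SAPJoining, §3.2 p. 10 and §4.4 p. 27, (4.9) (arXiv v5: the join polygon determines the junction);
Madras1995LatticeAnimalsExponent, §2 (the join is injective)] -/
theorem eq_of_unroot_of_cuts {M : ℕ} (hM : 2 ≤ M) {ρ₁ ρ₂ : ℕ → Site 2} (hω : ω ∈ loops (2 * M - 1))
    {r₁ r₂ : ℕ} (hr₁ : r₁ ≤ 2 * M - 1) (hr₂ : r₂ ≤ 2 * M - 1) {b₁ b₂ : Bool}
    (h₁ : unroot (2 * M - 1) (ω, r₁, b₁) = ρ₁) (h₂ : unroot (2 * M - 1) (ω, r₂, b₂) = ρ₂)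
    (c₁ : IsRowSepCut M (fun i => ρ₁ (i % (2 * M))) 0) (c₂ : IsRowSepCut M (fun i => ρ₂ (i % (2 * M))) 0)
    (hu₁ : ρ₁ (M - 1) 0 = 1) (hu₂ : ρ₂ (M - 1) 0 = 1) : ρ₁ = ρ₂ := by
  set n := 2 * M - 1 with hn
  have hL : n + 1 = 2 * M := by omega
  have hN1 : 1 ≤ M := by omega
  -- the cyclic reading of `ω` and its cuts
  set v : ℕ → Site 2 := fun i => ω (i % (2 * M)) with hv
  have hper : ∀ i, v (i + 2 * M) = v i := fun i => by simp only [hv, Nat.add_mod_right]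
  have hstep : ∀ i, brickGraph.Adj (v i) (v (i + 1)) := fun i => by
    have := mod_adj hω i; rwa [hL] at this
  -- each `ρₖ` produces a cut of `v`: at `rₖ` (forward) or at `rₖ + M + 1` (backward)
  have cutOf : ∀ {ρ : ℕ → Site 2} {r : ℕ} {b : Bool}, r ≤ n → unroot n (ω, r, b) = ρ →
      IsRowSepCut M (fun i => ρ (i % (2 * M))) 0 →
      (b = false ∧ IsRowSepCut M v r) ∨ (b = true ∧ IsRowSepCut M v (r + M + 1)) := by
    intro ρ r b hr hρ hc
    cases b
    · left; refine ⟨rfl, ?_⟩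
      have hρ' : (fun i => ρ (i % (2 * M))) = fun i => v (i + r) + (-ω r) := by
        funext i
        rw [← hρ]; unfold unroot; simp only [Bool.false_eq_true, if_false]
        rw [← hL, rotF_mod hr, hL]; simp only [hv]; abel
      rw [hρ'] at hc
      have := isRowSepCut_translate (ω r) hc
      simp only [neg_add_cancel_right] at this
      exact isRowSepCut_unshift hN1 this
    · right; refine ⟨rfl, ?_⟩
      have hρ' : (fun i => ρ (i % (2 * M))) = fun i => v (r + 2 * M - i % (2 * M)) + (-ω r) := by
        funext i
        rw [← hρ]; unfold unroot; simp only [if_true]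
        rw [← hL, rotB_mod hr, hL]
        simp only [hv]
        rw [sub_eq_add_neg]
      rw [hρ'] at hc
      have := isRowSepCut_translate (ω r) hc
      simp only [neg_add_cancel_right] at this
      exact isRowSepCut_reverse hN1 hper r this
  have k₁ := cutOf hr₁ h₁ c₁
  have k₂ := cutOf hr₂ h₂ c₂
  -- the value of `ρ (M-1)` in the two orientations
  have valF : ∀ {ρ : ℕ → Site 2} {r : ℕ}, r ≤ n → unroot n (ω, r, false) = ρ → ρ (M - 1) = v (M - 1 + r) - ω r := by
    intro ρ r hr hρ
    rw [← hρ]; unfold unroot; simp only [Bool.false_eq_true, if_false]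
    have := rotF_mod (ω := ω) hr (M - 1)
    rw [hL, Nat.mod_eq_of_lt (show M - 1 < 2 * M by omega)] at this
    rw [this]
  have valB : ∀ {ρ : ℕ → Site 2} {r : ℕ}, r ≤ n → unroot n (ω, r, true) = ρ → ρ (M - 1) = v (r + M + 1) - ω r := by
    intro ρ r hr hρ
    rw [← hρ]; unfold unroot; simp only [if_true]
    have := rotB_mod (ω := ω) hr (M - 1)
    rw [hL, Nat.mod_eq_of_lt (show M - 1 < 2 * M by omega)] at this
    rw [this]; simp only [hv]
    rw [show r + 2 * M - (M - 1) = r + M + 1 by omega]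
  have hωr : ∀ r, r ≤ n → ω r = v r := fun r hr => by simp only [hv, Nat.mod_eq_of_lt (show r < 2 * M by omega)]
  -- the backward cut index reduced below `2M`
  have jB : ∀ {r : ℕ}, r ≤ n → IsRowSepCut M v (r + M + 1) →
      ∃ j, j < 2 * M ∧ IsRowSepCut M v j ∧ (j = r + M + 1 ∨ j + 2 * M = r + M + 1) := by
    intro r hr hc
    by_cases hlt : r + M + 1 < 2 * M
    · exact ⟨r + M + 1, hlt, hc, Or.inl rfl⟩
    · refine ⟨r + M + 1 - 2 * M, by omega, ?_, Or.inr (by omega)⟩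
      have e : r + M + 1 = 2 * M + (r + M + 1 - 2 * M) := by omega
      rw [e] at hc
      have := isRowSepCut_shift hN1 hc
      have hfun : (fun i => v (i + 2 * M)) = v := funext hper
      rwa [hfun] at this
  rcases k₁ with ⟨hb₁, cut₁⟩ | ⟨hb₁, cut₁⟩ <;> rcases k₂ with ⟨hb₂, cut₂⟩ | ⟨hb₂, cut₂⟩ <;> subst hb₁ <;> subst hb₂
  · -- forward / forward: same root
    have := isRowSepCut_unique hN1 hper hstep (by omega) (by omega) cut₁ cut₂
    subst this; rw [← h₁, ← h₂]
  · -- forward / backward: orientations differ ⇒ `ρ₂ (M−1) = −ρ₁ (M−1)`, contradiction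
    exfalso
    obtain ⟨j, hj, cutj, hjr⟩ := jB hr₂ cut₂
    have e := isRowSepCut_unique hN1 hper hstep (show r₁ < 2 * M by omega) hj cut₁ cutj
    have x₁ := valF hr₁ h₁
    have x₂ := valB hr₂ h₂
    rw [hωr r₁ hr₁] at x₁
    rw [hωr r₂ hr₂] at x₂
    have p1 : v r₁ = v (r₂ + M + 1) := by
      rcases hjr with h | h
      · rw [e, h]
      · rw [e, ← hper j, h]
    have p2 : v (M - 1 + r₁) = v r₂ := by
      rcases hjr with h | h
      · rw [e, h, show M - 1 + (r₂ + M + 1) = r₂ + 2 * M by omega, hper]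
      · rw [show M - 1 + r₁ = r₂ by omega]
    rw [p1, p2] at x₁
    have a₁ := congrFun x₁ 0
    have a₂ := congrFun x₂ 0
    rw [hu₁] at a₁; rw [hu₂] at a₂
    simp only [Pi.sub_apply] at a₁ a₂
    omega
  · exfalso
    obtain ⟨j, hj, cutj, hjr⟩ := jB hr₁ cut₁
    have e := isRowSepCut_unique hN1 hper hstep hj (show r₂ < 2 * M by omega) cutj cut₂
    have x₁ := valB hr₁ h₁
    have x₂ := valF hr₂ h₂
    rw [hωr r₁ hr₁] at x₁
    rw [hωr r₂ hr₂] at x₂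
    have p1 : v r₂ = v (r₁ + M + 1) := by
      rcases hjr with h | h
      · rw [← e, h]
      · rw [← e, ← hper j, h]
    have p2 : v (M - 1 + r₂) = v r₁ := by
      rcases hjr with h | h
      · rw [← e, h, show M - 1 + (r₁ + M + 1) = r₁ + 2 * M by omega, hper]
      · rw [show M - 1 + r₂ = r₁ by omega]
    rw [p1, p2] at x₂
    have a₁ := congrFun x₁ 0
    have a₂ := congrFun x₂ 0
    rw [hu₁] at a₁; rw [hu₂] at a₂
    simp only [Pi.sub_apply] at a₁ a₂
    omega
  · -- backward / backward: same root
    obtain ⟨j₁, hj₁, cutj₁, hjr₁⟩ := jB hr₁ cut₁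
    obtain ⟨j₂, hj₂, cutj₂, hjr₂⟩ := jB hr₂ cut₂
    have e := isRowSepCut_unique hN1 hper hstep hj₁ hj₂ cutj₁ cutj₂
    have : r₁ = r₂ := by rcases hjr₁ with a | a <;> rcases hjr₂ with b | b <;> omega
    subst this; rw [← h₁, ← h₂]

end TriPolygon

end Literature.Probability.RandomPlanarGeometry.SAW
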